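import Summits.BirchSwinnertonDyer.BirchSwinnertonDyer.Theorems.GenusKolyvaginAtTwoCasselsTatePTcRealPackage
import Summits.BirchSwinnertonDyer.BirchSwinnertonDyer.Theorems.GenusKolyvaginAtTwoCasselsTatePTcTotallyComplex
import Summits.BirchSwinnertonDyer.BirchSwinnertonDyer.Theorems.SemiOrdinaryEisensteinDescentShaTwoCochainBridgeSum
import Literature.NumberTheory.GaloisRepresentations.HomDualLocalPairingPlace
import Literature.NumberTheory.GaloisCohomology.CyclicClassOfResEqZero
import Literature.NumberTheory.GaloisCohomology.PoitouTateSelmerStructuresRealPlaces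
import HarnessLib

/-!
# The Ш²-cochain bridge over a number field WITH REAL PLACES, step 2: the bridge sum with its ARCHIMEDEAN CORRECTION

Route `GenusKolyvaginAtTwo`, crux `KolyvaginExactAtTwo` (stmt-BirchSwinnertonDyer-22137) → Q3-inner, Cassels–Tate block at the
EVEN level OVER `ℚ` (LINE 6 capstone `hB₁`/`hB₂`; route item 19420 `CasselsTatePairingRat`); seat `bsd-line-gk2-p2` g13 (cell
`bsd-f1-sign2`), `--supports 22137`, helper. THEOREMS ONLY (no definition, no named fact, no `sorry`, no instance).

Cell bsd-wall's `ShaTwoCochain.exists_bridge_sum_localInvariants_eq_zero` (w3 g7) reads the sum `Σ_v inv_v = 0` of the canonical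
local terms of an admissible Poitou–Tate choice as the vanishing of the FINITE-place invariant sum of the bridge's idèle `2`-cocycle
`Z`, dropping the archimedean members of THE canonical family (zero at odd level). At even level over a field with a real place they
are not zero; this file carries them:

* §1 `twoCocycleClass_push_eq_cohomologyMap_place`, `twoCocycleClass_push_eq_zero_iff` — at ANY place `v`, a `K̄_vˣ`-valued
  `2`-cocycle with values `ι_v κ(z(s,t))` is `(μ-iso ≫ κ_v)_* [z]`, and vanishes iff `[z]` does (`H²(K_v, μ) ↪ H²(K_v, K̄_vˣ)`,
  Hilbert 90 — the tree's `cohomologyMap_kummerι_two_injective`);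
* §2 **`exists_bridge_sum_localInvariants_eq_zero_real`** — w3 g7's theorem for ANY number field and ANY level `m`: conjuncts
  (3)(4)(5)(a)(c) verbatim, `H³(K, μ) = 0` replaced by `Ш³ = 0` + local triviality of `γ` (step 1,
  `exists_bridgePackageMu_of_cupVanishing`), and (b′): a `2`-torsion archimedean correction `a w` with
  `Σ_{v ∈ T} inv_{K_v}[π_v Z|_v] + Σ_w a w = 0` and `a w = 0 ↔ [π_w Z|_w] = 0`.

Step 3 (sequel) reads the same correction off road B's readout (`localInvInf`, also `2`-torsion and zero iff the archimedean class
vanishes — two `2`-torsion elements of `ℚ/ℤ` with the same support are equal) and assembles `hPTc` over any number field.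
BSD is not proved by any of this.

References: [MilneADT2006] I §1 Ex. 1.6 (c), Lemma 4.13, Thm. 4.10 (a) (proof pp. 57–58), §6 Prop. 6.9; [CasselsFrohlichANT1967]
Ch. VII §11.2 (bis); [SerreLocalFields1979] X §1 Prop. 2 (Hilbert 90).
-/

noncomputable section

open scoped Classical

-- `Summit.<P>.<Sub>` repeats `BirchSwinnertonDyer` by the tree's layout convention (D-0017)
set_option linter.dupNamespace false
set_option autoImplicit false

namespace Summit.BirchSwinnertonDyer.BirchSwinnertonDyer.Theorems.GenusExact.CasselsTatePTcReal

open CategoryTheory _root_.WeierstrassCurve Field Function NumberField IsDedekindDomain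
open Literature.NumberTheory.EllipticCurves
open Literature.NumberTheory.GaloisRepresentations Literature.NumberTheory.GaloisRepresentations.HomDual
  Literature.NumberTheory.GaloisCohomology
open Literature.Algebra.Homology Literature.Algebra.Homology.DiscreteRep ContRepresentation Literature
open Literature.NumberTheory.GaloisRepresentations.DiscreteGaloisModule (units UnitsCarrier mu MuCarrier TateDual tateDual
  tateDualPairing pairingDualIntertwining)
open Literature.NumberTheory.GaloisRepresentations.IdeleClassBar (classBarD)
open Literature.NumberTheory.GaloisRepresentations.FreePresentation
open Literature.NumberTheory.GaloisRepresentations.DGMBridge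
open Literature.AnabelianGeometry.AbsoluteAnabelian (Prop121vii.brauerInvariantEquiv Prop121vii.zmodToQmodZ)
open Summit.BirchSwinnertonDyer.BirchSwinnertonDyer.Theorems.ShaTwoCochain
open scoped ContRepresentation NumberField

/-! ## §1 Local classes pushed along `μ ⊆ K̄_vˣ` at any place -/

section Push

variable {K : Type} [Field K] [NumberField K] {n : ℕ} [NeZero n]

/-- **Pointwise recognition of the push-forward at ANY place**: a `K̄_vˣ`-valued `2`-cocycle `z'` of `Γ_{K_v}` with
`z'(σ,τ) = ι_v (κ (z(σ,τ)))` for a `μₙ(K̄)|`-valued `2`-cocycle `z` has class `(muPlaceIso ≫ κ_v)_* [z]` (the tree's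
`twoCocycleClass_push_eq_cohomologyMap` at a finite place, verbatim at every place). [cite: MilneADT2006, I §0, I §1] -/
theorem twoCocycleClass_push_eq_cohomologyMap_place (v : Place K)
    (z : contTwoCocycles ((mu K n).toLocal v).toTopRep) (z' : contTwoCocycles (units (Place.Completion v)).toTopRep)
    (hz' : ∀ σ τ : Field.absoluteGaloisGroup (Place.Completion v),
      z'.1 (σ, τ) = unitsTransferAddHom K (Place.Completion v) (kummerInclAddHom K n (z.1 (σ, τ)))) :
    haveI := absoluteGaloisGroup_compactSpace (Place.Completion v)
    twoCocycleClass _ z' = cohomologyMap ((muPlaceIso v n).hom ≫ kummerι (Place.Completion v) n) 2 (twoCocycleClass _ z) := by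
  haveI := absoluteGaloisGroup_compactSpace (Place.Completion v)
  rw [cohomologyMap_twoCocycleClass]
  congr 1
  refine Subtype.ext (ContinuousMap.ext fun q => ?_)
  obtain ⟨σ, τ⟩ := q
  rw [hz', contTwoCocycles.pullback_apply, unitsTransferAddHom_kummerInclAddHom]
  rfl

/-- **… and it vanishes iff `[z]` does**: `H²(K_v, μₙ(K̄)|) ≅ H²(K_v, μₙ) ↪ H²(K_v, K̄_vˣ)` (Hilbert 90, the tree's
`cohomologyMap_kummerι_two_injective`). [cite: SerreLocalFields1979, X §1 Prop. 2] -/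
theorem twoCocycleClass_push_eq_zero_iff (v : Place K)
    (z : contTwoCocycles ((mu K n).toLocal v).toTopRep) (z' : contTwoCocycles (units (Place.Completion v)).toTopRep)
    (hz' : ∀ σ τ : Field.absoluteGaloisGroup (Place.Completion v),
      z'.1 (σ, τ) = unitsTransferAddHom K (Place.Completion v) (kummerInclAddHom K n (z.1 (σ, τ)))) :
    haveI := absoluteGaloisGroup_compactSpace (Place.Completion v)
    twoCocycleClass _ z' = 0 ↔ twoCocycleClass _ z = 0 := by
  haveI := absoluteGaloisGroup_compactSpace (Place.Completion v)
  rw [twoCocycleClass_push_eq_cohomologyMap_place v z z' hz', cohomologyMap_comp_apply]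
  refine ⟨fun h0 => ?_, fun h0 => ?_⟩
  swap
  · have h0' : twoCocycleClass ((mu K n).restrict (absGaloisRestrict K (Place.Completion v))).toTopRep z = 0 := h0
    rw [h0', map_zero, map_zero]
  have h1 : cohomologyMap (muPlaceIso v n).hom 2 (twoCocycleClass _ z) = 0 :=
    (injective_iff_map_eq_zero _).1 (cohomologyMap_kummerι_two_injective (Place.Completion v)) _ h0
  have h2 := congrArg (cohomologyMap (muPlaceIso v n).inv 2) h1
  rw [map_zero, ← cohomologyMap_comp_apply, Iso.hom_inv_id] at h2
  exact (map_apply_of_id _ (fun _ => rfl) _ (fun _ => rfl) 2 (twoCocycleClass _ z)).symm.trans h2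

end Push

/-! ## §2 The bridge sum with the archimedean correction -/

section BridgeSum

variable {K : Type} [Field K] [NumberField K] {W : WeierstrassCurve K} {m : ℕ} [NeZero m]
variable {e : geomTorsion W ((m * m : ℕ) : ℤ) → geomTorsion W ((m * m : ℕ) : ℤ) → AlgebraicClosure K}
  {hμ : ∀ S T, e S T ^ (m * m) = 1}
  {hadd₁ : ∀ S₁ S₂ T, e (S₁ + S₂) T = e S₁ T * e S₂ T}
  {hadd₂ : ∀ S T₁ T₂, e S (T₁ + T₂) = e S T₁ * e S T₂}
  {hgal : ∀ (σ : absoluteGaloisGroup K) (S T : geomTorsion W ((m * m : ℕ) : ℤ)), σ • e S T = e (σ • S) (σ • T)}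
variable [Finite (geomTorsion W (m : ℤ))]

/-- **The bridge's idèle cocycle over ANY number field (real places allowed), at EVERY level `m`**: under `hPTc` for `f`, for
`h : N₁ → C̄` with `Ψ h = θ′_* [f]` and a locally trivial `γ`, the bridge's idèle `2`-cocycle `Z` (class image `h ∘ ∂γ`) has finite
local Brauer invariants vanishing off a finite set (a), every local class `(m·m)`-torsion (c), and (b') a `2`-TORSION ARCHIMEDEAN
CORRECTION `a : {w ∣ ∞} → ℚ/ℤ`, `a w = 0 ↔` the archimedean local projection class of `Z` at `w` vanishes, such that
`Σ_{v ∈ T} inv_{K_v}[π_v Z|_v] + Σ_w a w = 0` for every large finite `T`.  (`a w` is `(1/m²)·inv_w` of the `μ_{m²}`-currency local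
term at `w`; the join at `w` is the injectivity of `H²(K_w, μ) → H²(K_w, K̄_wˣ)` (Hilbert 90) and of `inv_w` at a real place.)  Cell
bsd-wall's `exists_bridge_sum_localInvariants_eq_zero` (w3 g7) is the odd-level case, where `a = 0`.
[cite: MilneADT2006, I Thm. 4.10 (a) (proof, pp. 57–58), Ex. 1.6 (c), §6 proof of Prop. 6.9][cite: CasselsFrohlichANT1967, Ch. VII §11.2 (bis)] -/
theorem exists_bridge_sum_localInvariants_eq_zero_real [NeZero (m * m)]
    {f : contTwoCocycles (W.torsionGaloisModule (m : ℤ)).toTopRep}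
    (hf : ∀ g : contOneCocycles (W.torsionGaloisModule (m : ℤ)).toTopRep,
      (∀ v : Place K, locClass (W.torsionGaloisModule (m : ℤ)) (Place.Completion v)
          (resOne (W.torsionGaloisModule (m : ℤ)) (Place.Completion v) g) = 0) →
      ∃ (C : PTChoice W m e hμ hadd₁ hadd₂ hgal f g) (S : Finset (Place K)),
        (∀ v ∉ S, C.localTerm (LocalInvariants.canonical K (m * m)) v = 0) ∧
          ∑ v ∈ S, C.localTerm (LocalInvariants.canonical K (m * m)) v = 0)
    (h : (presentationComplex (W.torsionGaloisModule (m : ℤ))).X₁ ⟶ classBarD K)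
    (hh : shaTwoConnecting (W.torsionGaloisModule (m : ℤ)) (m * m)
        (FirstCaseData.mul_nsmul_geomTorsion_eq_zero (W := W) (m := m)) h =
      galoisCohomology.map (pairingDualIntertwining
        (ρ₁ := W.torsionGaloisModule (m : ℤ)) (ρ₂ := W.torsionGaloisModule (m : ℤ))
        (B := (descendHom W m m e hμ hadd₁ hadd₂).flip) (ShaTwoCochainTheta.descendHom_flip_smul W m e hμ hadd₁ hadd₂ hgal)) 2
        (twoCocycleClass _ f))
    {γ : contOneCocycles (W.torsionGaloisModule (m : ℤ)).toTopRep}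
    (hγ : ∀ v : Place K, locClass (W.torsionGaloisModule (m : ℤ)) (Place.Completion v)
      (resOne (W.torsionGaloisModule (m : ℤ)) (Place.Completion v) γ) = 0)
    (πs : (v : Place K) → HomDual.IdeleProjection K v) :
    haveI := moduleFinite_presModule₁ (W.torsionGaloisModule (m : ℤ))
    haveI := absoluteGaloisGroup_compactSpace K
    ∃ (c : contTwoCocycles (presModule₁ (W.torsionGaloisModule (m : ℤ))).toTopRep)
      (ht : DiscreteRep.HomCarrier (LCarrier (presentationComplex (W.torsionGaloisModule (m : ℤ))).X₁) (LCarrier (ideleBarD K)))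
      (Z : contTwoCocycles (toDGM (ideleBarD K)).toTopRep) (S' : Finset (Place K)),
      -- (3) `h̃` lifts `h`
      (∀ x : LCarrier (presentationComplex (W.torsionGaloisModule (m : ℤ))).X₁,
        ideleToClassI K ((show _ →ₗ[ℤ] LCarrier (ideleBarD K) from ht) x) =
          lmap (presentationComplex (W.torsionGaloisModule (m : ℤ))).X₁ (classBarD K) h x) ∧
      -- (4) `[c] = δ₁[γ]`
      (pres_isSES (W.torsionGaloisModule (m : ℤ))).δ₁ (oneCocycleClass _ γ) = twoCocycleClass _ c ∧
      -- (5) `jC ∘ Z = h ∘ c`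
      (∀ σ τ : absoluteGaloisGroup K,
        ideleToClassI K (Z.1 (σ, τ)) = lmap (presentationComplex (W.torsionGaloisModule (m : ℤ))).X₁ (classBarD K) h (c.1 (σ, τ))) ∧
      -- (a) off `S'` the finite local invariants of `Z` vanish
      (∀ (v : HeightOneSpectrum (𝓞 K))
        (cZ : haveI := charZero_adicCompletion v; contTwoCocycles (units (v.adicCompletion K)).toTopRep),
        (∀ s t : absoluteGaloisGroup (v.adicCompletion K), cZ.1 (s, t) =
          ((πs (Sum.inr v)).toAddMonoidHom.comp (LCarrier.val (ideleBarD K)))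
            (Z.1 (absGaloisRestrict K (v.adicCompletion K) s, absGaloisRestrict K (v.adicCompletion K) t))) →
        (Sum.inr v : Place K) ∉ S' →
        (haveI := charZero_adicCompletion v; haveI := absoluteGaloisGroup_compactSpace (v.adicCompletion K);
          Prop121vii.brauerInvariantEquiv (v.adicCompletion K) (twoCocycleClass (units (v.adicCompletion K)).toTopRep cZ)) = 0) ∧
      -- (b') the finite-place sum of the local invariants of `Z` PLUS AN ARCHIMEDEAN CORRECTION vanishes; the correction at
      -- `w` is `2`-torsion and vanishes iff the archimedean local projection class of `Z` at `w` does
      (∃ a : InfinitePlace K → AddCircle (1 : ℚ),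
        (∀ w : InfinitePlace K, 2 • a w = 0) ∧
        (∀ (w : InfinitePlace K) (cW : contTwoCocycles (units (Place.Completion (Sum.inl w : Place K))).toTopRep),
          (∀ s t : absoluteGaloisGroup (Place.Completion (Sum.inl w : Place K)), cW.1 (s, t) =
            ((πs (Sum.inl w)).toAddMonoidHom.comp (LCarrier.val (ideleBarD K)))
              (Z.1 (absGaloisRestrict K (Place.Completion (Sum.inl w : Place K)) s,
                absGaloisRestrict K (Place.Completion (Sum.inl w : Place K)) t))) →
          ((haveI := absoluteGaloisGroup_compactSpace (Place.Completion (Sum.inl w : Place K));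
            twoCocycleClass (units (Place.Completion (Sum.inl w : Place K))).toTopRep cW) = 0 ↔ a w = 0)) ∧
        ∀ (T : Finset (HeightOneSpectrum (𝓞 K))), (∀ v : HeightOneSpectrum (𝓞 K), (Sum.inr v : Place K) ∈ S' → v ∈ T) →
          ∀ (cZs : (v : HeightOneSpectrum (𝓞 K)) →
              haveI := charZero_adicCompletion v; contTwoCocycles (units (v.adicCompletion K)).toTopRep),
            (∀ (v : HeightOneSpectrum (𝓞 K)) (s t : absoluteGaloisGroup (v.adicCompletion K)), (cZs v).1 (s, t) =
              ((πs (Sum.inr v)).toAddMonoidHom.comp (LCarrier.val (ideleBarD K)))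
                (Z.1 (absGaloisRestrict K (v.adicCompletion K) s, absGaloisRestrict K (v.adicCompletion K) t))) →
            ∑ v ∈ T, (haveI := charZero_adicCompletion v; haveI := absoluteGaloisGroup_compactSpace (v.adicCompletion K);
              Prop121vii.brauerInvariantEquiv (v.adicCompletion K)
                (twoCocycleClass (units (v.adicCompletion K)).toTopRep (cZs v))) + ∑ w : InfinitePlace K, a w = 0) ∧
      -- (c) every local class of `Z` is `(m·m)`-torsion
      (∀ (v : Place K) (cZ : contTwoCocycles (units (Place.Completion v)).toTopRep),
        (∀ s t : absoluteGaloisGroup (Place.Completion v), cZ.1 (s, t) =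
          ((πs v).toAddMonoidHom.comp (LCarrier.val (ideleBarD K)))
            (Z.1 (absGaloisRestrict K (Place.Completion v) s, absGaloisRestrict K (Place.Completion v) t))) →
        (haveI := absoluteGaloisGroup_compactSpace (Place.Completion v);
          (m * m) • twoCocycleClass (units (Place.Completion v)).toTopRep cZ) = 0) := by
  haveI := moduleFinite_presModule₁ (W.torsionGaloisModule (m : ℤ))
  haveI := moduleFinite_presModule₂ (W.torsionGaloisModule (m : ℤ))
  haveI := absoluteGaloisGroup_compactSpace K
  -- the `μ`-currency bridge package, `H³` input from `Ш³ = 0` and the local triviality of `γ` at the real places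
  obtain ⟨Fb, Hb, c, ht, Z, h1, h2, h3, h4, h5, h6⟩ := exists_bridgePackageMu_of_cupVanishing (W.torsionGaloisModule (m : ℤ))
    (m * m) (FirstCaseData.mul_nsmul_geomTorsion_eq_zero (W := W) (m := m)) h γ
    (threeCocycleClass_cupCocycle₂₁_eq_zero_of_locallyTrivial (W.torsionGaloisModule (m : ℤ)) (m * m) γ
      fun w _ => hγ (Sum.inl w))
  choose φb lam hφb h6b using h6
  -- glue-L: the canonical local terms of the bridge's choice `(H♭; φ♭_v)` have finite support and sum zero
  have hclass : galoisCohomology.map (pairingDualIntertwining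
        (ρ₁ := W.torsionGaloisModule (m : ℤ)) (ρ₂ := W.torsionGaloisModule (m : ℤ))
        (B := (descendHom W m m e hμ hadd₁ hadd₂).flip) (ShaTwoCochainTheta.descendHom_flip_smul W m e hμ hadd₁ hadd₂ hgal)) 2
        (twoCocycleClass _ f) = twoCocycleClass _ Fb := hh.symm.trans h1
  obtain ⟨S', hoff, hsum⟩ := ShaTwoCochainTheta.evFlip_support_and_sum_eq_zero_of_class_eq hf Fb hclass hγ Hb h2
    (fun v => φb v (πs v)) (fun v => hφb v (πs v))
  -- abbreviation: the canonical local term at `v`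
  set t : (v : Place K) → ZMod (m * m) := fun v => LocalInvariants.canonical K (m * m) v
    (locClass₂ (mu K (m * m)) (Place.Completion v)
      ((((tateDualPairing (W.torsionGaloisModule (m : ℤ)) (m * m)).flip).restrict
          (absGaloisRestrict K (Place.Completion v))).cupSubCocycle (φb v (πs v))
        (resOne (W.torsionGaloisModule (m : ℤ)) (Place.Completion v) γ)
        (resTwo ((W.torsionGaloisModule (m : ℤ)).tateDual (m * m)) (Place.Completion v) Fb) (hφb v (πs v))
        (resCochain₂ (Place.Completion v) Hb)
        (dTwo_resCochain₂_of_cupCocycle₂₁ ((tateDualPairing (W.torsionGaloisModule (m : ℤ)) (m * m)).flip)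
          (fun v => ((tateDualPairing (W.torsionGaloisModule (m : ℤ)) (m * m)).flip).restrict
            (absGaloisRestrict K (Place.Completion v)))
          (fun _ _ _ => rfl) Hb h2 v))) with ht_def
  have hoff' : ∀ v ∉ S', t v = 0 := hoff
  have hsum' : ∑ v ∈ S', t v = 0 := hsum
  -- the per-place join at a finite place
  have hjoin : ∀ (v : HeightOneSpectrum (𝓞 K))
      (cZ : haveI := charZero_adicCompletion v; contTwoCocycles (units (v.adicCompletion K)).toTopRep),
      (∀ s t : absoluteGaloisGroup (v.adicCompletion K), cZ.1 (s, t) =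
        ((πs (Sum.inr v)).toAddMonoidHom.comp (LCarrier.val (ideleBarD K)))
          (Z.1 (absGaloisRestrict K (v.adicCompletion K) s, absGaloisRestrict K (v.adicCompletion K) t))) →
      (haveI := charZero_adicCompletion v; haveI := absoluteGaloisGroup_compactSpace (v.adicCompletion K);
        Prop121vii.brauerInvariantEquiv (v.adicCompletion K) (twoCocycleClass (units (v.adicCompletion K)).toTopRep cZ)) =
        Prop121vii.zmodToQmodZ (m * m) (t (Sum.inr v)) := fun v cZ hcZ =>
    brauerInvariantEquiv_localProjection_eq_zmodToQmodZ_canonical (W.torsionGaloisModule (m : ℤ)) (m * m) v Fb γ Hb h2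
      (φb (Sum.inr v) (πs (Sum.inr v))) (hφb (Sum.inr v) (πs (Sum.inr v))) (lam (Sum.inr v) (πs (Sum.inr v))) Z
      (πs (Sum.inr v)) cZ hcZ (h6b (Sum.inr v) (πs (Sum.inr v)))
  refine ⟨c, ht, Z, S', h3, h4, h5, fun v cZ hcZ hv => ?_, ?_, fun v cZ hcZ => ?_⟩
  · -- (a)
    rw [hjoin v cZ hcZ, hoff' _ hv, map_zero]
  · -- (b'): `a w := zmodToQmodZ (t (inl w))`
    refine ⟨fun w => Prop121vii.zmodToQmodZ (m * m) (t (Sum.inl w)), fun w => ?_, fun w cW hcW => ?_, fun T hT cZs hcZs => ?_⟩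
    · -- `2`-torsion: the archimedean invariant map takes values in `{0, n/2}`
      rw [← map_nsmul, ht_def]
      dsimp only
      rw [LocalInvariants.canonical_inl, two_nsmul_archimedeanInvariantMap, map_zero]
    · -- the join at the infinite place `w`: `[cW] = (μ-iso ≫ κ)_* [z_w]`, an injective image, and `inv_w` is injective at a real
      -- place / everything vanishes at a complex one
      haveI := absoluteGaloisGroup_compactSpace (Place.Completion (Sum.inl w : Place K))
      let z := (((tateDualPairing (W.torsionGaloisModule (m : ℤ)) (m * m)).flip).restrict
          (absGaloisRestrict K (Place.Completion (Sum.inl w : Place K)))).cupSubCocycle (φb (Sum.inl w) (πs (Sum.inl w)))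
        (resOne (W.torsionGaloisModule (m : ℤ)) (Place.Completion (Sum.inl w : Place K)) γ)
        (resTwo ((W.torsionGaloisModule (m : ℤ)).tateDual (m * m)) (Place.Completion (Sum.inl w : Place K)) Fb)
        (hφb (Sum.inl w) (πs (Sum.inl w)))
        (resCochain₂ (Place.Completion (Sum.inl w : Place K)) Hb)
        (dTwo_resCochain₂_of_cupCocycle₂₁ ((tateDualPairing (W.torsionGaloisModule (m : ℤ)) (m * m)).flip)
          (fun v => ((tateDualPairing (W.torsionGaloisModule (m : ℤ)) (m * m)).flip).restrict
            (absGaloisRestrict K (Place.Completion v)))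
          (fun _ _ _ => rfl) Hb h2 (Sum.inl w))
      let z' : contTwoCocycles (units (Place.Completion (Sum.inl w : Place K))).toTopRep :=
        cW - (units (Place.Completion (Sum.inl w : Place K))).twoCoboundary (lam (Sum.inl w) (πs (Sum.inl w)))
      have hz' : ∀ s₁ t₁ : absoluteGaloisGroup (Place.Completion (Sum.inl w : Place K)),
          z'.1 (s₁, t₁) = unitsTransferAddHom K (Place.Completion (Sum.inl w : Place K)) (kummerInclAddHom K (m * m) (z.1 (s₁, t₁))) := by
        intro s₁ t₁
        change cW.1 (s₁, t₁) -
          ((units (Place.Completion (Sum.inl w : Place K))).twoCoboundary (lam (Sum.inl w) (πs (Sum.inl w)))).1 (s₁, t₁) = _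
        rw [hcW, ContinuousRep.twoCoboundary_apply, ContPairing.cupSubCocycle_apply, ContPairing.restrict_toLin,
          ContPairing.flip_toLin_apply]
        exact (h6b (Sum.inl w) (πs (Sum.inl w)) s₁ t₁).symm
      have hcl : twoCocycleClass (units (Place.Completion (Sum.inl w : Place K))).toTopRep cW = twoCocycleClass _ z' := by
        change _ = twoCocycleClass _ (cW - (units (Place.Completion (Sum.inl w : Place K))).twoCoboundary
          (lam (Sum.inl w) (πs (Sum.inl w))))
        rw [twoCocycleClass_sub, ContinuousRep.twoCocycleClass_twoCoboundary, sub_zero]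
      rw [hcl, twoCocycleClass_push_eq_zero_iff (K := K) (n := m * m) (Sum.inl w) z z' hz',
        map_eq_zero_iff _ (Literature.AnabelianGeometry.AbsoluteAnabelian.Prop121vii.zmodToQmodZ_injective (m * m)), ht_def]
      dsimp only
      change twoCocycleClass _ z = 0 ↔ LocalInvariants.canonical K (m * m) (Sum.inl w) (twoCocycleClass _ z) = 0
      rcases w.isReal_or_isComplex with hw | hw
      · refine ⟨fun h0 => ?_, fun h0 => LocalInvariants.canonical_injectiveAtRealPlaces w hw (h0.trans (map_zero _).symm)⟩
        have h0' : twoCocycleClass ((mu K (m * m)).toLocal (Sum.inl w : Place K)).toTopRep z = 0 := h0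
        rw [h0']
        exact map_zero _
      · have hz0 : twoCocycleClass ((mu K (m * m)).toLocal (Sum.inl w : Place K)).toTopRep z = 0 :=
          CasselsTatePTc.twoCocycleClass_eq_zero_of_isComplex w hw _ z
        exact ⟨fun _ => by rw [hz0]; exact map_zero _, fun _ => hz0⟩
    · -- the sum: `Σ_{v ∈ T} inv_v + Σ_w a w = zmodToQmodZ (Σ_{v ∈ T} t (inr v) + Σ_w t (inl w)) = zmodToQmodZ (Σ_{S'} t) = 0`
      rw [Finset.sum_congr rfl fun v _ => hjoin v (cZs v) (hcZs v), ← map_sum, ← map_sum, ← map_add]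
      have hTS : ∑ v ∈ T, t (Sum.inr v) + ∑ w : InfinitePlace K, t (Sum.inl w) = ∑ w ∈ S', t w := by
        have hmapr : ∑ w ∈ T.map ⟨(Sum.inr : HeightOneSpectrum (𝓞 K) → Place K), Sum.inr_injective⟩, t w =
            ∑ v ∈ T, t (Sum.inr v) := Finset.sum_map _ _ _
        have hmapl : ∑ w ∈ (Finset.univ : Finset (InfinitePlace K)).map ⟨(Sum.inl : InfinitePlace K → Place K), Sum.inl_injective⟩,
            t w = ∑ w : InfinitePlace K, t (Sum.inl w) := Finset.sum_map _ _ _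
        have hdisj : Disjoint (T.map ⟨(Sum.inr : HeightOneSpectrum (𝓞 K) → Place K), Sum.inr_injective⟩)
            ((Finset.univ : Finset (InfinitePlace K)).map ⟨(Sum.inl : InfinitePlace K → Place K), Sum.inl_injective⟩) := by
          rw [Finset.disjoint_left]
          intro x hx hx'
          obtain ⟨v, -, rfl⟩ := Finset.mem_map.1 hx
          obtain ⟨w', -, hw'⟩ := Finset.mem_map.1 hx'
          exact Sum.inl_ne_inr hw'
        rw [← hmapr, ← hmapl, ← Finset.sum_union hdisj]
        symm
        refine Finset.sum_subset (fun x hx => ?_) fun x _ hx => hoff' x hx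
        rcases x with w' | v
        · exact Finset.mem_union_right _ (Finset.mem_map.2 ⟨w', Finset.mem_univ _, rfl⟩)
        · exact Finset.mem_union_left _ (Finset.mem_map.2 ⟨v, hT v hx, rfl⟩)
      rw [hTS, hsum', map_zero]
  · -- (c): `c_Z − dλ` has `μ_{m²}`-sourced values
    haveI := absoluteGaloisGroup_compactSpace (Place.Completion v)
    let z := (((tateDualPairing (W.torsionGaloisModule (m : ℤ)) (m * m)).flip).restrict
        (absGaloisRestrict K (Place.Completion v))).cupSubCocycle (φb v (πs v))
      (resOne (W.torsionGaloisModule (m : ℤ)) (Place.Completion v) γ)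
      (resTwo ((W.torsionGaloisModule (m : ℤ)).tateDual (m * m)) (Place.Completion v) Fb) (hφb v (πs v))
      (resCochain₂ (Place.Completion v) Hb)
      (dTwo_resCochain₂_of_cupCocycle₂₁ ((tateDualPairing (W.torsionGaloisModule (m : ℤ)) (m * m)).flip)
        (fun v => ((tateDualPairing (W.torsionGaloisModule (m : ℤ)) (m * m)).flip).restrict
          (absGaloisRestrict K (Place.Completion v)))
        (fun _ _ _ => rfl) Hb h2 v)
    let z' : contTwoCocycles (units (Place.Completion v)).toTopRep := cZ - (units (Place.Completion v)).twoCoboundary (lam v (πs v))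
    have hz' : ∀ s t : absoluteGaloisGroup (Place.Completion v),
        z'.1 (s, t) = unitsTransferAddHom K (Place.Completion v) (kummerInclAddHom K (m * m) (z.1 (s, t))) := by
      intro s t
      change cZ.1 (s, t) - ((units (Place.Completion v)).twoCoboundary (lam v (πs v))).1 (s, t) = _
      rw [hcZ, ContinuousRep.twoCoboundary_apply, ContPairing.cupSubCocycle_apply, ContPairing.restrict_toLin,
        ContPairing.flip_toLin_apply]
      exact (h6b v (πs v) s t).symm
    have hcl : twoCocycleClass (units (Place.Completion v)).toTopRep cZ = twoCocycleClass _ z' := by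
      change _ = twoCocycleClass _ (cZ - (units (Place.Completion v)).twoCoboundary (lam v (πs v)))
      rw [twoCocycleClass_sub, ContinuousRep.twoCocycleClass_twoCoboundary, sub_zero]
    have hz'0 : (m * m) • z' = 0 := by
      refine Subtype.ext (ContinuousMap.ext fun st => ?_)
      obtain ⟨s, t⟩ := st
      change (m * m) • z'.1 (s, t) = 0
      rw [hz', ← map_nsmul, ← map_nsmul, ← natCast_zsmul, zsmul_muCarrier_eq_zero, map_zero, map_zero]
    rw [hcl, ← twoCocycleClassₗ_apply, ← map_nsmul, hz'0, map_zero]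

end BridgeSum

end Summit.BirchSwinnertonDyer.BirchSwinnertonDyer.Theorems.GenusExact.CasselsTatePTcReal

end
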